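import Literature.AlgebraicGeometry.Modules.PullbackAffineChart
import Literature.AlgebraicGeometry.Modules.KernelFiniteLocallyFree
import Literature.AlgebraicGeometry.Modules.AffineVectorBundleSections
import Literature.AlgebraicGeometry.Modules.DetClassOfIso
import Literature.RingTheory.Flat.BasisLiftNilpotent
import Mathlib.LinearAlgebra.TensorProduct.Quotient
import Mathlib.RingTheory.Ideal.Quotient.Operations
import HarnessLib

/-!
# Frames of a rank-one module lift along a nilpotent thickening of an affine chart

Topic `Literature/AlgebraicGeometry/Modules`; theorems only (no definition, no named fact, no instance).
The sheaf-level form of «a lift of a basis modulo a nilpotent ideal is a basis» for RANK-ONE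
quasi-coherent modules on the tree's affine chart of a pull-back (★ `Modules/PullbackAffineChart`):

* `nonempty_frame_of_frame_pullback_of_nilpotent` — for `f : X ⟶ Y`, `M` quasi-coherent of rank one
  on `Y`, affine opens `V ⊆ Y`, `U ⊆ f⁻¹V` such that the chart map `f♯ : Γ(V, 𝒪_Y) → Γ(U, 𝒪_X)` is
  SURJECTIVE WITH NILPOTENT KERNEL (e.g. `X ↪ Y` a nilpotent thickening and `U = f⁻¹V`, or
  `X = P × Spec K ↪ Y = P × Spec R` for a local Artinian `R` with residue field `K`), a frame
  `𝒪_U ≅ (f^*M)|_U` yields a frame `𝒪_V ≅ M|_V`.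

Proof: on the chart `Γ(U, f^*M) = Γ(U) ⊗_{Γ(V)} Γ(V, M)` (★ `chartSectionsEquiv`,
`unitSectionLE_eq_comp`), so the reduction map `η : Γ(V, M) → Γ(U, f^*M)` is onto with kernel
`(ker f♯)·Γ(V, M)` (§1, `B ⊗_A T = T/(ker)T` for `A ↠ B`); `Γ(V, M)` is finite projective, hence flat
(★ `finite_projective_sections_of_isFiniteLocallyFree`); the frame downstairs is a basis vector
(★ `nonempty_basis_of_frame`), any lift of it is a basis of `Γ(V, M)` by the tree's
[Schlessinger1968, Lemma 3.4 (proof)] = ★ `Literature.RingTheory.Flat.exists_basis_of_lift_basis`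
(nilpotent Nakayama, [StacksProject, Tag 00DV (11)]), and a basis of sections on an affine open is a
frame (★ `nonempty_free_iso_over_of_basis`).  This is the chart step of the thickening induction in
[MumfordAV1970] §13 («lift the trivialisation»).

## References
* [StacksProject] Tag 00DV (Nakayama's lemma; (11): nilpotent `I`, no finiteness).
* [AtiyahMacdonald1969] M. Atiyah, I. Macdonald, *Introduction to Commutative Algebra*, Ch. 2,
  Exercise 2 (p. 31): `(A/𝔞) ⊗_A M ≅ M/𝔞M`.
* [Schlessinger1968] M. Schlessinger, *Functors of Artin rings*, Trans. AMS 130 (1968), Lemma 3.3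
  and proof of Lemma 3.4 (pp. 216–217).
* [MumfordAV1970] D. Mumford, *Abelian Varieties*, §13 (proof of the theorem on p. 125).
-/

universe u v

noncomputable section

open CategoryTheory AlgebraicGeometry TopologicalSpace Opposite TensorProduct
open scoped ChangeOfRings

namespace Literature.AlgebraicGeometry.Modules

/-! ### §1 `B ⊗_A T` for a surjection `A ↠ B`: every tensor is `1 ⊗ t`, and `1 ⊗ t = 0 ⇔ t ∈ (ker)·T` -/

section OneTmul

variable {A : Type u} [CommRing A] {B : Type u} [CommRing B] [Algebra A B]
  (T : Type v) [AddCommGroup T] [Module A T]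

/-- For a SURJECTIVE algebra map `A ↠ B`: `B ⊗_A T = (A ⧸ ker) ⊗_A T = T ⧸ (ker)·T`, so every element of
`B ⊗_A T` is `1 ⊗ t`, and `1 ⊗ t = 0 ⇔ t ∈ (ker) • T` (Mathlib `TensorProduct.quotTensorEquivQuotSMul` transported
along `A ⧸ ker ≃ₐ B`). [cite: AtiyahMacdonald1969, Ch. 2, Exercise 2 (p. 31)] -/
theorem one_tmul_surjective_and_eq_zero_iff (hψ : Function.Surjective (algebraMap A B)) :
    (∀ q : B ⊗[A] T, ∃ t : T, q = (1 : B) ⊗ₜ[A] t) ∧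
      (∀ t : T, (1 : B) ⊗ₜ[A] t = 0 ↔ t ∈ RingHom.ker (algebraMap A B) • (⊤ : Submodule A T)) := by
  let I : Ideal A := RingHom.ker (algebraMap A B)
  have hker : RingHom.ker (Algebra.ofId A B : A →ₐ[A] B) = I := rfl
  let eB : (A ⧸ I) ≃ₐ[A] B :=
    (Ideal.quotientEquivAlgOfEq A hker.symm).trans (Ideal.quotientKerAlgEquivOfSurjective (f := Algebra.ofId A B) hψ)
  have heB : ∀ a : A, eB (Ideal.Quotient.mk I a) = algebraMap A B a := by
    intro a
    change Ideal.quotientKerAlgEquivOfSurjective hψ (Ideal.quotientEquivAlgOfEq A hker.symm (Ideal.Quotient.mk I a)) = _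
    rw [Ideal.quotientEquivAlgOfEq_mk, Ideal.quotientKerAlgEquivOfSurjective_apply]
    rfl
  have heB1 : eB.symm 1 = Ideal.Quotient.mk I 1 := by
    apply eB.injective; rw [AlgEquiv.apply_symm_apply, heB, map_one]
  -- `B ⊗ T ≃ (A/I) ⊗ T ≃ T / I T`
  let E : B ⊗[A] T ≃ₗ[A] T ⧸ (I • (⊤ : Submodule A T)) :=
    (TensorProduct.congr eB.symm.toLinearEquiv (LinearEquiv.refl A T)).trans (TensorProduct.quotTensorEquivQuotSMul T I)
  have hE : ∀ t : T, E ((1 : B) ⊗ₜ[A] t) = Submodule.Quotient.mk t := by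
    intro t
    change TensorProduct.quotTensorEquivQuotSMul T I
      (TensorProduct.congr eB.symm.toLinearEquiv (LinearEquiv.refl A T) ((1 : B) ⊗ₜ[A] t)) = _
    rw [TensorProduct.congr_tmul, LinearEquiv.refl_apply, AlgEquiv.toLinearEquiv_apply, heB1,
      TensorProduct.quotTensorEquivQuotSMul_mk_tmul, one_smul]
  refine ⟨fun q => ?_, fun t => ?_⟩
  · obtain ⟨t, ht⟩ := Submodule.Quotient.mk_surjective _ (E q)
    refine ⟨t, E.injective ?_⟩
    rw [hE, ht]
  · rw [← Submodule.Quotient.mk_eq_zero (p := I • ⊤), ← hE, LinearEquiv.map_eq_zero_iff]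

end OneTmul

section OneTmulCompHom

variable {A : Type u} [CommRing A] {B : Type u} [CommRing B] (ψ : A →+* B)
  (T : Type v) [AddCommGroup T] [Module A T]

/-- `one_tmul_surjective_and_eq_zero_iff` for the `Module.compHom B ψ` structure used by Mathlib's
`ModuleCat.extendScalars ψ` (the tree's chart tensor `Γ(U) ⊗_{Γ(V), f♯} Γ(V, M)`).
[cite: AtiyahMacdonald1969, Ch. 2, Exercise 2 (p. 31)] -/
theorem one_tmul_surjective_and_eq_zero_iff_compHom (hψ : Function.Surjective ψ) :
    letI : Module A B := Module.compHom B ψ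
    Function.Surjective (fun t : T => (1 : B) ⊗ₜ[A] t) ∧
      (∀ t : T, (1 : B) ⊗ₜ[A] t = 0 ↔ t ∈ RingHom.ker ψ • (⊤ : Submodule A T)) := by
  letI : Algebra A B := ψ.toAlgebra
  obtain ⟨h₁, h₂⟩ := one_tmul_surjective_and_eq_zero_iff T (B := B) hψ
  exact ⟨fun q => by obtain ⟨t, ht⟩ := h₁ q; exact ⟨t, ht.symm⟩, h₂⟩

end OneTmulCompHom


/-- `x ∈ I • T₁ ⇔ e x ∈ I • T₂` for a linear equivalence `e : T₁ ≃ T₂` (plumbing). [folklore] -/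
private theorem mem_smul_top_iff_of_linearEquiv {A : Type u} [CommRing A] {T₁ : Type v} {T₂ : Type v}
    [AddCommGroup T₁] [Module A T₁] [AddCommGroup T₂] [Module A T₂] (e : T₁ ≃ₗ[A] T₂) (I : Ideal A) (x : T₁) :
    x ∈ I • (⊤ : Submodule A T₁) ↔ e x ∈ I • (⊤ : Submodule A T₂) := by
  have hmap : (I • (⊤ : Submodule A T₁)).map (e : T₁ →ₗ[A] T₂) = I • ⊤ := by
    rw [Submodule.map_smul'', Submodule.map_top, LinearEquiv.range]
  rw [← hmap, Submodule.mem_map_equiv, LinearEquiv.symm_apply_apply]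

/-! ### §2 Frames over the affine chart of a pull-back along a nilpotent thickening -/

section Chart

open Literature.AlgebraicGeometry.Motives Literature.AlgebraicGeometry.KTheory

variable {X Y : Scheme.{u}} (f : X ⟶ Y) (M : Y.Modules) [M.IsQuasicoherent] (hM : HasRank M 1)
  {V : Y.Opens} (hV : IsAffineOpen V) {U : X.Opens} (hU : IsAffineOpen U) (i : U ≤ f ⁻¹ᵁ V)

include hM hV hU in
/-- **Nilpotent Nakayama for rank-one frames, sheaf form.**  Let `f : X ⟶ Y`, `M` quasi-coherent of rank one on
`Y`, `V ⊆ Y` and `U ⊆ f⁻¹V` affine opens such that the chart map `f♯ : Γ(V, 𝒪_Y) → Γ(U, 𝒪_X)` is surjective with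
nilpotent kernel (e.g. `X ↪ Y` a nilpotent thickening and `U = f⁻¹V`, or `X = P × Spec K ↪ Y = P × Spec R` for a
local Artinian `R` with residue field `K`).  Then a frame `𝒪_U ≅ (f^*M)|_U` yields a frame `𝒪_V ≅ M|_V`.  Proof: on
the chart `Γ(U, f^*M) = Γ(U) ⊗_{Γ(V)} Γ(V, M)` (★ `chartSectionsEquiv`), `Γ(V, M)` is finite projective (★), the
frame is a basis vector downstairs (★ `nonempty_basis_of_frame`), any lift of it is a basis of the flat module
`Γ(V, M)` (★ `RingTheory.Flat.exists_basis_of_lift_basis`, [Schlessinger1968] proof of Lemma 3.4), and a basis of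
sections on an affine open is a frame (★ `nonempty_free_iso_over_of_basis`).
[cite: StacksProject, Tag 00DV (11)] [cite: Schlessinger1968, Lemma 3.4 (proof), p. 217] [cite: MumfordAV1970, §13 (proof of the Thm. p. 125)] -/
theorem nonempty_frame_of_frame_pullback_of_nilpotent
    (hψ : Function.Surjective (f.appLE V U i).hom) (hN : IsNilpotent (RingHom.ker (f.appLE V U i).hom))
    (e₀ : SheafOfModules.free (PUnit : Type u) ≅ ((Scheme.Modules.pullback f).obj M).over U) :
    Nonempty (SheafOfModules.free (PUnit : Type u) ≅ M.over V) := by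
  classical
  have hfl : IsFiniteLocallyFree M := HasRank.isFiniteLocallyFree' hM
  have hK : IsAffineLocalizing M := IsAffineLocalizing.of_isQuasicoherent M
  -- `Γ(V, M)` is (finite) projective, hence flat
  haveI := (finite_projective_sections_of_isFiniteLocallyFree hfl hV).2
  -- the basis vector downstairs
  obtain ⟨bP⟩ := nonempty_basis_of_frame e₀
  -- the reduction map `η = (m ↦ η(m)|_U)`, semilinear over the chart map `ψ = f♯`
  let η : Γ(M, V) →ₛₗ[(chartHom f i).hom] Γ((Scheme.Modules.pullback f).obj M, U) :=
    { toFun := unitSectionLE f M i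
      map_add' := unitSectionLE_add f M i
      map_smul' := unitSectionLE_smul f M i }
  have hη : ∀ x, η x = unitSectionLE f M i x := fun _ => rfl
  -- `Γ(U, f^*M) = Γ(U) ⊗_{Γ(V), f♯} Γ(V, M)` with `η = (1 ⊗ ·)`, and `Γ(V) ↠ Γ(U)`
  have h1 := one_tmul_surjective_and_eq_zero_iff_compHom (chartHom f i).hom (restrictTop M hV) hψ
  have hcompx : ∀ x, unitSectionLE f M i x = chartSectionsEquiv f M hV hU i hK
      ((1 : Γ(X, U)) ⊗ₜ[Γ(Y, V), (chartHom f i).hom] (appTopRestrictFromSpecEquiv M hV x)) :=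
    fun x => congrFun (unitSectionLE_eq_comp f M hV hU i hK) x
  -- `η` is surjective (the pattern of ★ `unitSectionLE_bijective_of`) with kernel `(ker f♯) · Γ(V, M)`
  have hsurj : Function.Surjective (unitSectionLE f M i) := by
    rw [unitSectionLE_eq_comp f M hV hU i hK]
    exact (chartSectionsEquiv f M hV hU i hK).surjective.comp
      (h1.1.comp (appTopRestrictFromSpecEquiv M hV).surjective)
  have hker : LinearMap.ker η = RingHom.ker (chartHom f i).hom • (⊤ : Submodule Γ(Y, V) Γ(M, V)) := by
    ext x
    rw [LinearMap.mem_ker, hη, hcompx, (chartSectionsEquiv f M hV hU i hK).map_eq_zero_iff]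
    refine (h1.2 (appTopRestrictFromSpecEquiv M hV x)).trans ?_
    exact (mem_smul_top_iff_of_linearEquiv (appTopRestrictFromSpecEquiv M hV) _ x).symm
  -- lift the basis vector and conclude with [Schlessinger1968, 3.4 (proof)]
  obtain ⟨m, hm⟩ := hsurj (bP PUnit.unit)
  obtain ⟨b, -⟩ := Literature.RingTheory.Flat.exists_basis_of_lift_basis hψ hN η hker bP (fun _ => m)
    (fun _ => by rw [hη, hm])
  exact nonempty_free_iso_over_of_basis M hK hV b

end Chart

end Literature.AlgebraicGeometry.Modules

end
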